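import Mathlib
import HarnessLib
import Summits.HubbardSuperconductivity.HubbardSuperconductivity.Theorems.KLProgrammeKLRegimeSplitLegDressingQ2

/-!
# Route `KLProgramme` — ENGINE child (stmt-HubbardSuperconductivity-19918 / gen-6 successor), (E2-v10) leg-dress line: the per-leg dressing size
# at the OPPOSITE reading frequency `−ω₀`, and the four legs of a PAIR configuration with their `±ω₀` tags
# (cell gate-hubbard-kl, seat hubbard-kl-k3c2-p3 g3, row «leg-dress bar»; sequel to `…SplitLegDressing` / `…SplitLegDressingQ2`)

`klld_leg_dressing_le` / `klld_sum_leg_dressing_le` / `klld_legDress_le_legDressBarQ2` read every leg at `+ω₀`, but the pair labels of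
`PairLadderStepAtV10` are `(ω₀,k′)↑, (−ω₀,Q−k′)↓, (−ω₀,Q−k)↓, (ω₀,k)↑`.  At `−ω₀` nothing changes: the cutoff weights read `t(k⃗)` through `ω²`
(`klld_weight_omega0_rev`), the slice entry obeys the same bound (`klld_norm_covSliceCT_mode_omega0_rev_le`), and under (E0) `Σ_m(−ω₀,k⃗,σ) =
conj Σ_m(ω₀,k⃗,σ)` has the same norm (`klld_norm_selfEnergy_rev_eq`).  Hence `klld_leg_dressing_rev_le` (the per-leg size at `−ω₀`, verbatim
majorant), the TAGGED four-leg sum `klld_sum_leg_dressing_tagged_le` (each leg at its own frequency `ω_i ∈ {ω₀, −ω₀}`, counted by the same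
`legSliceCountT … n k`), and **`klld_legDress_tagged_le_legDressBarQ2`** — the plain-carrier leg-dress term of ANY `±ω₀` configuration is within
`legDressBarQ2 G P Q U n (legSliceCountT … n k)` under the history slots and `128·cr + 64·cz ≤ Q.CR·Klam` (met at `klEngQ3/Q5`,
`…EngineV8LegDressThreshold`).  Proved; no definitions.
-/

noncomputable section

namespace Summit.HubbardSuperconductivity.HubbardSuperconductivity.Theorems.KLRegimeSplit

set_option linter.dupNamespace false -- summit = problem name (single-conjunct summit), D-0017

open Real Finset Literature.MathematicalPhysics.QuantumLattice Literature.Probability.LatticeModels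
open Summit.HubbardSuperconductivity.HubbardSuperconductivity.Theorems.KLProgrammeLegKernels

section Model

variable {L M : ℕ} [NeZero L] [NeZero M]

omit [NeZero L] in
/-- The cutoff weight does not see the sign of the reading frequency: `w_Λ(−ω₀,k⃗) = w_Λ(ω₀,k⃗)`. -/
theorem klld_weight_rev_eq (β μ : ℝ) (K : TrigPolyC4v) (Λ : ℝ) (k : TorusSite 2 L) :
    hubbardCutoffWeightCT L M β μ K Λ ((omega0 M).rev, k) = hubbardCutoffWeightCT L M β μ K Λ (omega0 M, k) := by
  rw [klld_weight_omega0_rev, klld_weight_omega0]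

/-- Under (E0) the self-energy at `−ω₀` is the conjugate of the one at `ω₀`, so the norms agree. -/
theorem klld_norm_selfEnergy_rev_eq {β U μ : ℝ} {K : TrigPolyC4v} {m : ℕ} (hE0 : SelfEnergySymmetric L M β U μ K m)
    (k : TorusSite 2 L) (σ : Fin 2) :
    ‖klSelfEnergy L M β U μ K klE0 m ((omega0 M).rev, k) σ‖ = ‖klSelfEnergy L M β U μ K klE0 m (omega0 M, k) σ‖ := by
  rw [(hE0 k σ).1, Complex.norm_conj]

/-- **The slice entry on one mode at `−ω₀`**: same majorant as at `ω₀` — `≤ 2βL²·|Δw(ω₀,k⃗)|/t(k⃗)`. -/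
theorem klld_norm_covSliceCT_mode_omega0_rev_le {β : ℝ} (hβ : 0 < β) (μ : ℝ) (K : TrigPolyC4v) (Λ Λ' : ℝ)
    (k : TorusSite 2 L) (σ : Fin 2) (c c' : Fin 2) :
    ‖hubbardCovSliceCT L M β μ 0 K Λ Λ' ((((omega0 M).rev, k), σ), c) ((((omega0 M).rev, k), σ), c')‖ ≤
      2 * (β * (L : ℝ) ^ 2) *
        (|hubbardCutoffWeightCT L M β μ K Λ (omega0 M, k) - hubbardCutoffWeightCT L M β μ K Λ' (omega0 M, k)| *
          (klLegRadius L β μ K k)⁻¹) := by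
  have h := klld_norm_covSliceCT_zero_seed_le hβ μ K Λ Λ' ((((omega0 M).rev, k), σ), c) ((((omega0 M).rev, k), σ), c')
  simp only [momentumOf, klFreqRadius_omega0_rev, klld_weight_rev_eq] at h
  linarith

/-- **THE PER-LEG DRESSING SIZE AT `−ω₀`** (twin of `klld_leg_dressing_le`, same majorant): at step `n ≥ 1`, under (E0)/`RenormalisedAtF R (n−1)`/
`TwoLegSlopes R (n−1)`,
`‖(C^K_{>Λ_n} − C^K_{>Λ_{n−1}})((−ω₀,k⃗,σ,c),(−ω₀,k⃗,σ,c'))‖ · ‖Σ_{n−1}(−ω₀,k⃗,σ)‖ ≤ βL²·(64·cr·|U|·4^{−n} + 16·cz·|U| + 4·cz·|U|·(π/β)/Λ_n)`. -/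
theorem klld_leg_dressing_rev_le {β U μ : ℝ} (hβ : 0 < β) {K : TrigPolyC4v} {R : RenConsts} (hcr : 0 ≤ R.cr) (hcz : 0 ≤ R.cz)
    {n : ℕ} (hn : 1 ≤ n) (hE0 : SelfEnergySymmetric L M β U μ K (n - 1)) (hren : RenormalisedAtF L M β U μ K R (n - 1))
    (hsl : TwoLegSlopes L M R β U μ K (n - 1)) (k : TorusSite 2 L) (σ c c' : Fin 2) :
    ‖hubbardCovSliceCT L M β μ 0 K (klScale klE0 n) (klScale klE0 (n - 1)) ((((omega0 M).rev, k), σ), c)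
          ((((omega0 M).rev, k), σ), c')‖ *
        ‖klSelfEnergy L M β U μ K klE0 (n - 1) ((omega0 M).rev, k) σ‖ ≤
      β * (L : ℝ) ^ 2 *
        (64 * R.cr * |U| * ((4 : ℝ) ^ n)⁻¹ + 16 * R.cz * |U| + 4 * R.cz * |U| * ((Real.pi / β) / klScale klE0 n)) := by
  have hΛ := klth_klScale_pos n
  have hβL : 0 ≤ β * (L : ℝ) ^ 2 := by positivity
  have hU := abs_nonneg U
  have hπβ : 0 ≤ Real.pi / β := (div_pos Real.pi_pos hβ).le
  have hRHS : 0 ≤ β * (L : ℝ) ^ 2 *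
      (64 * R.cr * |U| * ((4 : ℝ) ^ n)⁻¹ + 16 * R.cz * |U| + 4 * R.cz * |U| * ((Real.pi / β) / klScale klE0 n)) := by
    positivity
  rw [klld_norm_selfEnergy_rev_eq hE0 k σ]
  by_cases hw : hubbardCutoffWeightCT L M β μ K (klScale klE0 n) (omega0 M, k) =
      hubbardCutoffWeightCT L M β μ K (klScale klE0 (n - 1)) (omega0 M, k)
  · -- off the window the entry vanishes (the weights at `−ω₀` are those at `ω₀`)
    have hw' : hubbardCutoffWeightCT L M β μ K (klScale klE0 n) (momentumOf L M ((((omega0 M).rev, k), σ), c)) =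
        hubbardCutoffWeightCT L M β μ K (klScale klE0 (n - 1)) (momentumOf L M ((((omega0 M).rev, k), σ), c)) := by
      simpa [momentumOf, klld_weight_rev_eq] using hw
    have hw'' : hubbardCutoffWeightCT L M β μ K (klScale klE0 n) (momentumOf L M ((((omega0 M).rev, k), σ), c')) =
        hubbardCutoffWeightCT L M β μ K (klScale klE0 (n - 1)) (momentumOf L M ((((omega0 M).rev, k), σ), c')) := by
      simpa [momentumOf, klld_weight_rev_eq] using hw
    have h0 := klld_covSliceCT_apply_eq_zero L M β μ 0 K (klScale klE0 n) (klScale klE0 (n - 1))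
      ((((omega0 M).rev, k), σ), c) ((((omega0 M).rev, k), σ), c') hw' hw''
    rw [h0, norm_zero, zero_mul]
    exact hRHS
  · -- on the window: entry `≤ 2βL²·(2/Λ_n)`, the leg sits in `S_{n-1}`, vertex bound from the slots (at `ω₀`, same norm)
    have hentry := klld_norm_covSliceCT_mode_omega0_rev_le (M := M) hβ μ K (klScale klE0 n) (klScale klE0 (n - 1)) k σ c c'
    have hrad := klld_inv_radius_lt_of_weight_ne L M β μ K n k hw
    have hw1 := salmhoferCutoff_mem_Icc (((Real.pi / β) ^ 2 + nambuXiCT L μ K k ^ 2) / klScale klE0 n ^ 2)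
    have hw2 := salmhoferCutoff_mem_Icc (((Real.pi / β) ^ 2 + nambuXiCT L μ K k ^ 2) / klScale klE0 (n - 1) ^ 2)
    have habs : |hubbardCutoffWeightCT L M β μ K (klScale klE0 n) (omega0 M, k) -
        hubbardCutoffWeightCT L M β μ K (klScale klE0 (n - 1)) (omega0 M, k)| ≤ 1 := by
      simp only [hubbardCutoffWeightCT, matsubaraFreq_omega0] at *
      rw [abs_le]; constructor <;> linarith [hw1.1, hw1.2, hw2.1, hw2.2]
    have hinv0 : 0 ≤ (klLegRadius L β μ K k)⁻¹ := inv_nonneg.mpr (Real.sqrt_nonneg _)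
    have hE : ‖hubbardCovSliceCT L M β μ 0 K (klScale klE0 n) (klScale klE0 (n - 1)) ((((omega0 M).rev, k), σ), c)
        ((((omega0 M).rev, k), σ), c')‖ ≤ 2 * (β * (L : ℝ) ^ 2) * (2 / klScale klE0 n) := by
      refine hentry.trans (mul_le_mul_of_nonneg_left ?_ (by positivity))
      calc _ ≤ 1 * (klLegRadius L β μ K k)⁻¹ := mul_le_mul_of_nonneg_right habs hinv0
        _ ≤ 2 / klScale klE0 n := by rw [one_mul]; exact hrad.le
    have hshell := klld_mem_klShell_pred_of_weight_ne β μ K k hw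
    have hV := klld_norm_selfEnergy_le_uniform hβ hcz hE0 hren hsl hshell σ
    have hV0 : 0 ≤ ‖klSelfEnergy L M β U μ K klE0 (n - 1) (omega0 M, k) σ‖ := norm_nonneg _
    have hE0' : 0 ≤ 2 * (β * (L : ℝ) ^ 2) * (2 / klScale klE0 n) := by positivity
    have hres := klld_residual_dressing_arith R.cr U hn
    have hslo := klld_dressing_slope_part R.cz U hn
    calc _ ≤ (2 * (β * (L : ℝ) ^ 2) * (2 / klScale klE0 n)) *
          (R.cr * |U| * klScale klE0 (n - 1) ^ 2 / klE0 + R.cz * |U| * (klScale klE0 (n - 1) + Real.pi / β)) :=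
          mul_le_mul hE hV hV0 hE0'
      _ = β * (L : ℝ) ^ 2 * (2 * (2 / klScale klE0 n * (R.cr * |U| * klScale klE0 (n - 1) ^ 2 / klE0)) +
            2 * (2 / klScale klE0 n * (R.cz * |U| * klScale klE0 (n - 1))) +
              4 * R.cz * |U| * ((Real.pi / β) / klScale klE0 n)) := by ring
      _ = _ := by rw [hres, hslo]; ring

/-- **Either reading frequency**: the per-leg dressing size at `ω ∈ {ω₀, −ω₀}`. -/
theorem klld_leg_dressing_tagged_le {β U μ : ℝ} (hβ : 0 < β) {K : TrigPolyC4v} {R : RenConsts} (hcr : 0 ≤ R.cr) (hcz : 0 ≤ R.cz)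
    {n : ℕ} (hn : 1 ≤ n) (hE0 : SelfEnergySymmetric L M β U μ K (n - 1)) (hren : RenormalisedAtF L M β U μ K R (n - 1))
    (hsl : TwoLegSlopes L M R β U μ K (n - 1)) {ω : MatsubaraIdx M} (hω : ω = omega0 M ∨ ω = (omega0 M).rev)
    (k : TorusSite 2 L) (σ c c' : Fin 2) :
    ‖hubbardCovSliceCT L M β μ 0 K (klScale klE0 n) (klScale klE0 (n - 1)) (((ω, k), σ), c) (((ω, k), σ), c')‖ *
        ‖klSelfEnergy L M β U μ K klE0 (n - 1) (ω, k) σ‖ ≤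
      β * (L : ℝ) ^ 2 *
        (64 * R.cr * |U| * ((4 : ℝ) ^ n)⁻¹ + 16 * R.cz * |U| + 4 * R.cz * |U| * ((Real.pi / β) / klScale klE0 n)) := by
  rcases hω with rfl | rfl
  · exact klld_leg_dressing_le hβ hcr hcz hn hE0 hren hsl k σ c c'
  · exact klld_leg_dressing_rev_le hβ hcr hcz hn hE0 hren hsl k σ c c'

/-- **The four legs of a `±ω₀` configuration, summed with the count** (twin of `klld_sum_leg_dressing_le` with a frequency tag per leg). -/
theorem klld_sum_leg_dressing_tagged_le {β U μ : ℝ} (hβ : 0 < β) {K : TrigPolyC4v} {R : RenConsts} (hcr : 0 ≤ R.cr) (hcz : 0 ≤ R.cz)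
    {n : ℕ} (hn : 1 ≤ n) (hE0 : SelfEnergySymmetric L M β U μ K (n - 1)) (hren : RenormalisedAtF L M β U μ K R (n - 1))
    (hsl : TwoLegSlopes L M R β U μ K (n - 1)) {ω : Fin 4 → MatsubaraIdx M} (hω : ∀ i, ω i = omega0 M ∨ ω i = (omega0 M).rev)
    (k : Fin 4 → TorusSite 2 L) (σ c c' : Fin 4 → Fin 2) :
    ∑ i : Fin 4, ‖hubbardCovSliceCT L M β μ 0 K (klScale klE0 n) (klScale klE0 (n - 1)) (((ω i, k i), σ i), c i)
        (((ω i, k i), σ i), c' i)‖ * ‖klSelfEnergy L M β U μ K klE0 (n - 1) (ω i, k i) (σ i)‖ ≤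
      β * (L : ℝ) ^ 2 *
          (64 * R.cr * |U| * ((4 : ℝ) ^ n)⁻¹ + 16 * R.cz * |U| + 4 * R.cz * |U| * ((Real.pi / β) / klScale klE0 n)) *
        (legSliceCountT L β μ K n k : ℝ) := by
  have hΛ := klth_klScale_pos n
  have hπβ : 0 ≤ Real.pi / β := (div_pos Real.pi_pos hβ).le
  have hz0 : 0 ≤ β * (L : ℝ) ^ 2 *
      (64 * R.cr * |U| * ((4 : ℝ) ^ n)⁻¹ + 16 * R.cz * |U| + 4 * R.cz * |U| * ((Real.pi / β) / klScale klE0 n)) := by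
    positivity
  have hb := fun i => klld_leg_dressing_tagged_le (L := L) (M := M) hβ hcr hcz hn hE0 hren hsl (hω i) (k i) (σ i) (c i) (c' i)
  -- the weights at `ω_i` are those at `ω₀`
  have hwt : ∀ i (Λ : ℝ), hubbardCutoffWeightCT L M β μ K Λ (ω i, k i) = hubbardCutoffWeightCT L M β μ K Λ (omega0 M, k i) := by
    intro i Λ
    rcases hω i with h | h
    · rw [h]
    · rw [h, klld_weight_rev_eq]
  have h0 : ∀ i : Fin 4, ¬ (hubbardCutoffWeightCT L M β μ K (klScale klE0 n) (omega0 M, k i) ≠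
        hubbardCutoffWeightCT L M β μ K (klScale klE0 (n - 1)) (omega0 M, k i)) →
      ‖hubbardCovSliceCT L M β μ 0 K (klScale klE0 n) (klScale klE0 (n - 1)) (((ω i, k i), σ i), c i)
          (((ω i, k i), σ i), c' i)‖ * ‖klSelfEnergy L M β U μ K klE0 (n - 1) (ω i, k i) (σ i)‖ = 0 := by
    intro i hi
    have hw : hubbardCutoffWeightCT L M β μ K (klScale klE0 n) (omega0 M, k i) =
        hubbardCutoffWeightCT L M β μ K (klScale klE0 (n - 1)) (omega0 M, k i) := not_not.mp hi
    have hw' : hubbardCutoffWeightCT L M β μ K (klScale klE0 n) (momentumOf L M (((ω i, k i), σ i), c i)) =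
        hubbardCutoffWeightCT L M β μ K (klScale klE0 (n - 1)) (momentumOf L M (((ω i, k i), σ i), c i)) := by
      simp only [momentumOf, hwt]; exact hw
    have hw'' : hubbardCutoffWeightCT L M β μ K (klScale klE0 n) (momentumOf L M (((ω i, k i), σ i), c' i)) =
        hubbardCutoffWeightCT L M β μ K (klScale klE0 (n - 1)) (momentumOf L M (((ω i, k i), σ i), c' i)) := by
      simp only [momentumOf, hwt]; exact hw
    rw [klld_covSliceCT_apply_eq_zero L M β μ 0 K (klScale klE0 n) (klScale klE0 (n - 1)) (((ω i, k i), σ i), c i)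
      (((ω i, k i), σ i), c' i) hw' hw'', norm_zero, zero_mul]
  have hcount := klld_card_dressed_le_countT L M β μ K hn k
  exact klld_sum_le_mul_of_card_le hz0 h0 hb hcount

/-- **`klld_legDress_tagged_le_legDressBarQ2`** — the plain-carrier leg-dress term of ANY `±ω₀` four-leg configuration is within the (E2-v10)
budget term: at step `n`, `1 ≤ n ≤ n_β + 1`, under (E0)/`RenormalisedAtF R (n−1)`/`TwoLegSlopes R (n−1)` and `128·cr + 64·cz ≤ Q.CR·Klam`,
for any value `v ≤ Klam·|U|`:
`(βL²)⁻¹ · (2v · Σ_i ‖slice entry_i‖·‖Σ_{n−1}(ω_i,k_i,σ_i)‖) ≤ legDressBarQ2 G P Q U n (legSliceCountT … n k)`.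
In `PairLadderStepAtV10` take `ω = (ω₀, −ω₀, −ω₀, ω₀)`, `k = (k′, Q−k′, Q−k, k)`. -/
theorem klld_legDress_tagged_le_legDressBarQ2 {β U μ : ℝ} (hβ : klBetaMin ≤ β) {K : TrigPolyC4v} {R : RenConsts} (hcr : 0 ≤ R.cr)
    (hcz : 0 ≤ R.cz) {n : ℕ} (hn1 : 1 ≤ n) (hn : n ≤ nScales β + 1) (hE0 : SelfEnergySymmetric L M β U μ K (n - 1))
    (hren : RenormalisedAtF L M β U μ K R (n - 1)) (hsl : TwoLegSlopes L M R β U μ K (n - 1))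
    (G : GeoConsts) {P : SplitConsts} {Q : EngConsts} (hK : 0 ≤ P.Klam) (hQ0 : 0 ≤ Q.CR) (hCR : 128 * R.cr + 64 * R.cz ≤ Q.CR * P.Klam)
    {v : ℝ} (hv0 : 0 ≤ v) (hv : v ≤ P.Klam * |U|) {ω : Fin 4 → MatsubaraIdx M} (hω : ∀ i, ω i = omega0 M ∨ ω i = (omega0 M).rev)
    (k : Fin 4 → TorusSite 2 L) (σ c c' : Fin 4 → Fin 2) :
    (β * (L : ℝ) ^ 2)⁻¹ * (2 * v *
        ∑ i : Fin 4, ‖hubbardCovSliceCT L M β μ 0 K (klScale klE0 n) (klScale klE0 (n - 1)) (((ω i, k i), σ i), c i)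
            (((ω i, k i), σ i), c' i)‖ * ‖klSelfEnergy L M β U μ K klE0 (n - 1) (ω i, k i) (σ i)‖) ≤
      legDressBarQ2 G P Q U n (legSliceCountT L β μ K n k) := by
  have hβ0 : 0 < β := pos_of_klBetaMin_le hβ
  have hL : (0 : ℝ) < (L : ℝ) := Nat.cast_pos.2 (Nat.pos_of_ne_zero (NeZero.ne L))
  have hβL : 0 < β * (L : ℝ) ^ 2 := by positivity
  have hS := klld_sum_leg_dressing_tagged_le (L := L) (M := M) (μ := μ) hβ0 hcr hcz hn1 hE0 hren hsl hω k σ c c'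
  have hbr := klld_bracket_le (U := U) hβ hcr hcz hn
  have hcnt : (0 : ℝ) ≤ (legSliceCountT L β μ K n k : ℝ) := Nat.cast_nonneg _
  have hfin := legDress_size_le_legDressBarQ2 G hK hQ0 hcr hcz hCR U n hv (legSliceCountT L β μ K n k)
  set B := 64 * R.cr * |U| * ((4 : ℝ) ^ n)⁻¹ + 16 * R.cz * |U| + 4 * R.cz * |U| * ((Real.pi / β) / klScale klE0 n) with hB
  have h1 : (β * (L : ℝ) ^ 2)⁻¹ * (2 * v * ∑ i : Fin 4,
      ‖hubbardCovSliceCT L M β μ 0 K (klScale klE0 n) (klScale klE0 (n - 1)) (((ω i, k i), σ i), c i)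
          (((ω i, k i), σ i), c' i)‖ * ‖klSelfEnergy L M β U μ K klE0 (n - 1) (ω i, k i) (σ i)‖) ≤
      (β * (L : ℝ) ^ 2)⁻¹ * (2 * v * (β * (L : ℝ) ^ 2 * B * (legSliceCountT L β μ K n k : ℝ))) :=
    mul_le_mul_of_nonneg_left (mul_le_mul_of_nonneg_left hS (by positivity)) (inv_pos.2 hβL).le
  refine h1.trans ?_
  rw [show (β * (L : ℝ) ^ 2)⁻¹ * (2 * v * (β * (L : ℝ) ^ 2 * B * (legSliceCountT L β μ K n k : ℝ))) =
      2 * v * B * (legSliceCountT L β μ K n k : ℝ) by field_simp]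
  calc 2 * v * B * (legSliceCountT L β μ K n k : ℝ)
      ≤ 2 * v * ((64 * R.cr + 32 * R.cz) * |U|) * (legSliceCountT L β μ K n k : ℝ) :=
        mul_le_mul_of_nonneg_right (mul_le_mul_of_nonneg_left hbr (by positivity)) hcnt
    _ ≤ legDressBarQ2 G P Q U n (legSliceCountT L β μ K n k) := hfin

end Model

end Summit.HubbardSuperconductivity.HubbardSuperconductivity.Theorems.KLRegimeSplit

end
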